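import Summits.MatrixMultiplication.OmegaCensus.DicyclicLaw128Classes
import HarnessLib

/-!
# The dicyclic law at `|A| = 128`: not attained whenever `A/⟨c₀⟩ ↠ ℤ₄ × ℤ₄`

ω-census `pub-omega`, family (b3), seat pub-omega-group gen 14.  Framing: lottery ticket; floor = certified bounds/negative
ranges.  VALUE: kernel theorems about the group-theoretic method (TPP capacity of dihedral-like groups); NOT progress on ω.

**Theorem (`no_dicyclic_law_card_128_of_onto_z4z4`).** Let `G(A, c₀)` be of dicyclic type (`c₀ ≠ 0`), `|A| = 128`, and
let `Φ : A →+ ZMod 4 × ZMod 4` be onto with `Φ c₀ = 0`.  Then no TPP triple of `G` attains `3|S||T||U| + 16 = 8|A|`.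

This covers every `(A, c₀)` of order `|A| = 128` whose quotient `A/⟨c₀⟩` is `ℤ₈²` or `ℤ₄ × ℤ₁₆` (the two cells of `2`-rank `2`
left open by gen 12/13, whose methods needed `A/⟨c₀⟩ ↠ 𝔽₂³`), and re-proves the `2`-rank-`≥ 3` quotients containing `ℤ₄²`.
With `dicyclic_law_iff_of_quot` (attained when `A/⟨c₀⟩ ∈ {ℤ₆₄, ℤ₂ × ℤ₃₂}`) and `no_dicyclic_law_of_two_group_quot` (the other
quotients of `2`-rank `≥ 3`) the dicyclic law at `|A| = 128` is classified completely:
**attained ⟺ `A/⟨c₀⟩` has a cyclic subgroup of index `≤ 2`.**  Instances: `z8_z16_dicyclic_no_law_0_8` (`A/⟨c₀⟩ ≅ ℤ₈²`),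
`z8_z16_dicyclic_no_law_4_0` (`ℤ₄ × ℤ₁₆`), `z2_z8_z8_dicyclic_no_law` (`ℤ₈²`).

*Proof.*  (Class theorems in `DicyclicLaw128Classes.lean`.)  Gen 12's classification of dicyclic-law shapes (`two_balanced_of_vertex_bounds31`: P1 two dominoes, B balanced,
N1/N2/N3) and its `2`-group class theorems are reused verbatim up to their last line: each produces a member stable under a
central involution (`n2_parts_periodic_aux`, `n3_stable_member_aux`, `classB_parts_periodic`, saturation for P1) or the
four-coset cover (`n1_four_cosets`); the conclusion is now drawn from `no_dicyclic_law_of_stable_member_128`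
(`DicyclicLawZ4Z4Reduction.lean`: the `a = c₀` descent lands in `Dih(A/⟨c₀⟩)` of order `64` mapping onto `ℤ₄²`, where
`no_mod_one_law_card_64_of_onto_z4z4` applies) and from `not_four_cosets_of_onto_z4z4`.  The `2`-group `B = A/⟨c₀⟩` of the
class theorems is the quotient itself (`2⁷ · B = 0`).
-/

namespace Summit.MatrixMultiplication.OmegaCensus

open Literature.Combinatorics.Additive Finset



/-! ## Assembly -/

section Assembly

variable {A : Type} [AddCommGroup A] [DecidableEq A] [Fintype A] {G : Type} [Group G] [DecidableEq G]
  {ρ τ : A → G} {c₀ : A} {B : Type} [AddCommGroup B] [DecidableEq B] [Fintype B]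

/-- Two balanced members (`|S₀| = |S₁|`, `|T₀| = |T₁|`), `|A| = 128`, `A/⟨c₀⟩ ↠ ℤ₄²`: no dicyclic law (classes P1, B, N1,
N2, N3 as in `no_dicyclic_law_of_two_balanced`). [folklore] -/
theorem no_dicyclic_law_of_two_balanced_128
    (hρρ : ∀ a b, ρ a * ρ b = ρ (a + b)) (hρτ : ∀ a b, ρ a * τ b = τ (b - a))
    (hτρ : ∀ a b, τ a * ρ b = τ (a + b)) (hττ : ∀ a b, τ a * τ b = ρ (c₀ + b - a)) (hc₀ : c₀ ≠ 0)
    (hρ : Function.Injective ρ) (hτ : Function.Injective τ) (hne : ∀ a b, ρ a ≠ τ b)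
    (hsurj : ∀ g, (∃ a, ρ a = g) ∨ (∃ a, τ a = g)) (hA : Fintype.card A = 128)
    (Φ : A →+ ZMod 4 × ZMod 4) (hΦ : Function.Surjective Φ) (hΦc : Φ c₀ = 0)
    (π : A →+ B) (hπ : Function.Surjective π) (hker : ∀ a : A, π a = 0 ↔ a = 0 ∨ a = c₀)
    {m : ℕ} (hB : ∀ b : B, (2 ^ m) • b = 0)
    {S T U : Finset G} (h : TripleProductProperty S T U)
    (hs : (univ.filter fun a : A => ρ a ∈ S).card = (univ.filter fun a : A => τ a ∈ S).card)
    (ht : (univ.filter fun a : A => ρ a ∈ T).card = (univ.filter fun a : A => τ a ∈ T).card) :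
    3 * (S.card * T.card * U.card) + 16 ≠ 8 * Fintype.card A := by
  intro hV
  obtain ⟨s, hs₀⟩ : ∃ s, (univ.filter fun a : A => ρ a ∈ S).card = s := ⟨_, rfl⟩
  obtain ⟨t, ht₀⟩ : ∃ t, (univ.filter fun a : A => ρ a ∈ T).card = t := ⟨_, rfl⟩
  obtain ⟨u₀, hu₀⟩ : ∃ u, (univ.filter fun a : A => ρ a ∈ U).card = u := ⟨_, rfl⟩
  obtain ⟨u₁, hu₁⟩ : ∃ u, (univ.filter fun a : A => τ a ∈ U).card = u := ⟨_, rfl⟩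
  have hs₁ : (univ.filter fun a : A => τ a ∈ S).card = s := by rw [← hs, hs₀]
  have ht₁ : (univ.filter fun a : A => τ a ∈ T).card = t := by rw [← ht, ht₀]
  have cS : S.card = s + s := by rw [card_eq_parts' hρ hτ hne hsurj S, hs₀, hs₁]
  have cT : T.card = t + t := by rw [card_eq_parts' hρ hτ hne hsurj T, ht₀, ht₁]
  have cU : U.card = u₀ + u₁ := by rw [card_eq_parts' hρ hτ hne hsurj U, hu₀, hu₁]
  obtain ⟨h000, h111, -⟩ := vertex_counting' hρρ hρτ hτρ hττ hρ hτ hne h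
  rw [hs₀, hs₁, ht₀, ht₁, hu₀, hu₁] at h000 h111
  have hV' := hV
  rw [cS, cT, cU] at hV'
  -- the unbalance `d` of `U` and the bound `s t d ≤ 4`
  obtain ⟨d, hd, hstd⟩ : ∃ d, (u₀ = u₁ + d ∨ u₁ = u₀ + d) ∧ s * t * d ≤ 4 := by
    rcases le_total u₁ u₀ with hle | hle
    · obtain ⟨d, rfl⟩ := Nat.exists_eq_add_of_le hle
      refine ⟨d, Or.inl rfl, ?_⟩
      have e1 : s * t * (u₁ + d) = s * t * u₁ + s * t * d := by ring
      have e2 : (s + s) * (t + t) * (u₁ + d + u₁) = 8 * (s * t * u₁) + 4 * (s * t * d) := by ring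
      rw [e1] at h000; rw [e2] at hV'; omega
    · obtain ⟨d, rfl⟩ := Nat.exists_eq_add_of_le hle
      refine ⟨d, Or.inr rfl, ?_⟩
      have e1 : s * t * (u₀ + d) = s * t * u₀ + s * t * d := by ring
      have e2 : (s + s) * (t + t) * (u₀ + (u₀ + d)) = 8 * (s * t * u₀) + 4 * (s * t * d) := by ring
      rw [e1] at h111; rw [e2] at hV'; omega
  -- class B
  rcases Nat.eq_zero_or_pos d with rfl | hdpos
  · have hu : (univ.filter fun a : A => ρ a ∈ U).card = (univ.filter fun a : A => τ a ∈ U).card := by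
      rw [hu₀, hu₁]; omega
    exact no_classB_dicyclic_law_128 hρρ hρτ hτρ hττ hc₀ hρ hτ hne hsurj hA Φ hΦ hΦc π hker hB h hs ht hu hV
  have hU : (univ.filter fun a : A => ρ a ∈ U).card ≠ (univ.filter fun a : A => τ a ∈ U).card := by
    rw [hu₀, hu₁]; omega
  have hst : s * t ≤ 4 := le_trans (Nat.le_mul_of_pos_right _ hdpos) hstd
  rcases Nat.eq_zero_or_pos s with rfl | hspos
  · simp at hV'; omega
  rcases Nat.eq_zero_or_pos t with rfl | htpos
  · simp at hV'; omega
  have hs4 : s ≤ 4 := le_trans (Nat.le_mul_of_pos_right _ htpos) hst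
  have ht4 : t ≤ 4 := le_trans (Nat.le_mul_of_pos_left _ hspos) hst
  interval_cases s <;> interval_cases t
  all_goals first
    | omega
    | -- two dominoes
      exact no_dicyclic_law_of_two_domino_128 hρρ hρτ hτρ hττ hc₀ hρ hτ hne hsurj hA Φ hΦ hΦc h hs₀ hs₁ ht₀ ht₁ hV
    | -- class N1, roles `(S, T, U)`
      exact no_n1_dicyclic_law_z4z4 hρρ hρτ hτρ hττ hc₀ hρ hτ hne hsurj Φ hΦ hΦc π hπ hker hB h hs₀ hs₁ ht₀ ht₁ hU
        hV
    | -- class N1, roles `(T, S, U)`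
      exact no_n1_dicyclic_law_z4z4 hρρ hρτ hτρ hττ hc₀ hρ hτ hne hsurj Φ hΦ hΦc π hπ hker hB
        (tpp_reverse h).rotate ht₀ ht₁ hs₀ hs₁ hU
        (by rw [show T.card * S.card * U.card = S.card * T.card * U.card by ring]; exact hV)
    | -- class N3
      exact no_n3_dicyclic_law_128 hρρ hρτ hτρ hττ hc₀ hρ hτ hne hsurj hA Φ hΦ hΦc π hker hB h hs₀ hs₁ ht₀ ht₁ hV
    | -- class N2, roles `(S, U, T)`
      exact no_n2_dicyclic_law_128 hρρ hρτ hτρ hττ hc₀ hρ hτ hne hsurj hA Φ hΦ hΦc π hker hB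
        (tpp_reverse h).rotate.rotate hs₀ hs₁ ht₀ ht₁
        (by rw [show S.card * U.card * T.card = S.card * T.card * U.card by ring]; exact hV)
    | -- class N2, roles `(T, U, S)`
      exact no_n2_dicyclic_law_128 hρρ hρτ hτρ hττ hc₀ hρ hτ hne hsurj hA Φ hΦ hΦc π hker hB
        h.rotate ht₀ ht₁ hs₀ hs₁
        (by rw [show T.card * U.card * S.card = S.card * T.card * U.card by ring]; exact hV)

/-- **The dicyclic law at `|A| = 128` is not attained when `A/⟨c₀⟩ ↠ ℤ₄ × ℤ₄`.**  Dicyclic type `G(A, c₀)` (`c₀ ≠ 0`),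
`|A| = 128`, `Φ : A →+ ZMod 4 × ZMod 4` onto with `Φ c₀ = 0`.  For every TPP triple: `3|S||T||U| + 16 ≠ 8|A|`.
[folklore] -/
theorem no_dicyclic_law_card_128_of_onto_z4z4
    (hρρ : ∀ a b, ρ a * ρ b = ρ (a + b)) (hρτ : ∀ a b, ρ a * τ b = τ (b - a))
    (hτρ : ∀ a b, τ a * ρ b = τ (a + b)) (hττ : ∀ a b, τ a * τ b = ρ (c₀ + b - a)) (hc₀ : c₀ ≠ 0)
    (hρ : Function.Injective ρ) (hτ : Function.Injective τ) (hne : ∀ a b, ρ a ≠ τ b)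
    (hsurj : ∀ g, (∃ a, ρ a = g) ∨ (∃ a, τ a = g)) (hA : Fintype.card A = 128)
    (Φ : A →+ ZMod 4 × ZMod 4) (hΦ : Function.Surjective Φ) (hΦc : Φ c₀ = 0)
    {S T U : Finset G} (h : TripleProductProperty S T U) :
    3 * (S.card * T.card * U.card) + 16 ≠ 8 * Fintype.card A := by
  classical
  intro hV
  -- the `2`-group quotient `B = A/⟨c₀⟩`
  have h2c₀ : c₀ + c₀ = 0 := two_c0_eq_zero hρτ hτρ hττ hτ
  let K : AddSubgroup A := AddSubgroup.zmultiples c₀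
  let π : A →+ A ⧸ K := QuotientAddGroup.mk' K
  have hker : ∀ x : A, π x = 0 ↔ x = 0 ∨ x = c₀ := by
    intro x
    rw [QuotientAddGroup.mk'_apply, QuotientAddGroup.eq_zero_iff]
    exact mem_zmultiples_of_two h2c₀ x
  have hπ : Function.Surjective π := QuotientAddGroup.mk'_surjective K
  have hB : ∀ b : A ⧸ K, (2 ^ 7) • b = 0 := by
    intro b
    obtain ⟨x, rfl⟩ := hπ b
    rw [← map_nsmul, show (2 ^ 7 : ℕ) = Fintype.card A by rw [hA]; norm_num, card_nsmul_eq_zero, map_zero]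
  obtain ⟨h000, h111, h100, h011, h010, h101, h001, h110⟩ := vertex_counting' hρρ hρτ hτρ hττ hρ hτ hne h
  have hV' := hV
  rw [card_eq_parts' hρ hτ hne hsurj S, card_eq_parts' hρ hτ hne hsurj T, card_eq_parts' hρ hτ hne hsurj U] at hV'
  rcases two_balanced_of_vertex_bounds31 _ _ _ _ _ _ _ h000 h111 h100 h011 h010 h101 h001 h110 (by omega)
      (by omega) with ⟨hs, ht⟩ | ⟨hs, hu⟩ | ⟨ht, hu⟩
  · exact no_dicyclic_law_of_two_balanced_128 hρρ hρτ hτρ hττ hc₀ hρ hτ hne hsurj hA Φ hΦ hΦc π hπ hker hB h hs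
      ht hV
  · have := no_dicyclic_law_of_two_balanced_128 hρρ hρτ hτρ hττ hc₀ hρ hτ hne hsurj hA Φ hΦ hΦc π hπ hker hB
      h.rotate.rotate hu hs
    exact this (by rw [show U.card * S.card * T.card = S.card * T.card * U.card by ring]; exact hV)
  · have := no_dicyclic_law_of_two_balanced_128 hρρ hρτ hτρ hττ hc₀ hρ hτ hne hsurj hA Φ hΦ hΦc π hπ hker hB
      h.rotate ht hu
    exact this (by rw [show T.card * U.card * S.card = S.card * T.card * U.card by ring]; exact hV)

end Assembly

/-! ## Instances at `|A| = 128` with `A/⟨c₀⟩ ∈ {ℤ₈², ℤ₄ × ℤ₁₆}` -/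

section Instances

/-- **`G(ℤ₈ × ℤ₁₆, (0,8))` (`A/⟨c₀⟩ ≅ ℤ₈²`, order `256`): the dicyclic law `3V + 16 = 8·128` is not attained.** [folklore] -/
theorem z8_z16_dicyclic_no_law_0_8 [Fact (((0, 8) : ZMod 8 × ZMod 16) + (0, 8) = 0)]
    (S T U : Finset (DihedralLikeGroup (ZMod 8 × ZMod 16) (0, 8)))
    (h : Literature.Combinatorics.Additive.TripleProductProperty S T U) :
    3 * (S.card * T.card * U.card) + 16 ≠ 8 * Fintype.card (ZMod 8 × ZMod 16) := by
  refine no_dicyclic_law_card_128_of_onto_z4z4 (A := ZMod 8 × ZMod 16) (c₀ := (0, 8))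
    DihedralLikeGroup.rho_mul_rho DihedralLikeGroup.rho_mul_tau DihedralLikeGroup.tau_mul_rho
    DihedralLikeGroup.tau_mul_tau (by decide) DihedralLikeGroup.rho_injective DihedralLikeGroup.tau_injective
    DihedralLikeGroup.rho_ne_tau DihedralLikeGroup.rho_or_tau (by simp)
    ((ZMod.castHom (show 4 ∣ 8 by norm_num) (ZMod 4)).toAddMonoidHom.prodMap
      (ZMod.castHom (show 4 ∣ 16 by norm_num) (ZMod 4)).toAddMonoidHom) ?_ (by decide) h
  intro q
  obtain ⟨a, ha⟩ := ZMod.castHom_surjective (show 4 ∣ 8 by norm_num) (n := 8) q.1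
  obtain ⟨b, hb⟩ := ZMod.castHom_surjective (show 4 ∣ 16 by norm_num) (n := 16) q.2
  exact ⟨(a, b), Prod.ext ha hb⟩

/-- **`G(ℤ₈ × ℤ₁₆, (4,0))` (`A/⟨c₀⟩ ≅ ℤ₄ × ℤ₁₆`): the dicyclic law is not attained.** [folklore] -/
theorem z8_z16_dicyclic_no_law_4_0 [Fact (((4, 0) : ZMod 8 × ZMod 16) + (4, 0) = 0)]
    (S T U : Finset (DihedralLikeGroup (ZMod 8 × ZMod 16) (4, 0)))
    (h : Literature.Combinatorics.Additive.TripleProductProperty S T U) :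
    3 * (S.card * T.card * U.card) + 16 ≠ 8 * Fintype.card (ZMod 8 × ZMod 16) := by
  refine no_dicyclic_law_card_128_of_onto_z4z4 (A := ZMod 8 × ZMod 16) (c₀ := (4, 0))
    DihedralLikeGroup.rho_mul_rho DihedralLikeGroup.rho_mul_tau DihedralLikeGroup.tau_mul_rho
    DihedralLikeGroup.tau_mul_tau (by decide) DihedralLikeGroup.rho_injective DihedralLikeGroup.tau_injective
    DihedralLikeGroup.rho_ne_tau DihedralLikeGroup.rho_or_tau (by simp)
    ((ZMod.castHom (show 4 ∣ 8 by norm_num) (ZMod 4)).toAddMonoidHom.prodMap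
      (ZMod.castHom (show 4 ∣ 16 by norm_num) (ZMod 4)).toAddMonoidHom) ?_ (by decide) h
  intro q
  obtain ⟨a, ha⟩ := ZMod.castHom_surjective (show 4 ∣ 8 by norm_num) (n := 8) q.1
  obtain ⟨b, hb⟩ := ZMod.castHom_surjective (show 4 ∣ 16 by norm_num) (n := 16) q.2
  exact ⟨(a, b), Prod.ext ha hb⟩

/-- **`G(ℤ₂ × ℤ₈ × ℤ₈, (1,0,0))` (`A/⟨c₀⟩ ≅ ℤ₈²`): the dicyclic law is not attained.** [folklore] -/
theorem z2_z8_z8_dicyclic_no_law [Fact (((1, 0, 0) : ZMod 2 × ZMod 8 × ZMod 8) + (1, 0, 0) = 0)]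
    (S T U : Finset (DihedralLikeGroup (ZMod 2 × ZMod 8 × ZMod 8) (1, 0, 0)))
    (h : Literature.Combinatorics.Additive.TripleProductProperty S T U) :
    3 * (S.card * T.card * U.card) + 16 ≠ 8 * Fintype.card (ZMod 2 × ZMod 8 × ZMod 8) := by
  refine no_dicyclic_law_card_128_of_onto_z4z4 (A := ZMod 2 × ZMod 8 × ZMod 8) (c₀ := (1, 0, 0))
    DihedralLikeGroup.rho_mul_rho DihedralLikeGroup.rho_mul_tau DihedralLikeGroup.tau_mul_rho
    DihedralLikeGroup.tau_mul_tau (by decide) DihedralLikeGroup.rho_injective DihedralLikeGroup.tau_injective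
    DihedralLikeGroup.rho_ne_tau DihedralLikeGroup.rho_or_tau (by simp)
    (((ZMod.castHom (show 4 ∣ 8 by norm_num) (ZMod 4)).toAddMonoidHom.prodMap
      (ZMod.castHom (show 4 ∣ 8 by norm_num) (ZMod 4)).toAddMonoidHom).comp
      (AddMonoidHom.snd (ZMod 2) (ZMod 8 × ZMod 8))) ?_ (by decide) h
  intro q
  obtain ⟨a, ha⟩ := ZMod.castHom_surjective (show 4 ∣ 8 by norm_num) (n := 8) q.1
  obtain ⟨b, hb⟩ := ZMod.castHom_surjective (show 4 ∣ 8 by norm_num) (n := 8) q.2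
  exact ⟨(0, a, b), Prod.ext ha hb⟩

end Instances

end Summit.MatrixMultiplication.OmegaCensus
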